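import Literature.NumberTheory.EllipticCurves.Darmon2004.HeegnerPointReflection
import Literature.NumberTheory.EllipticCurves.HeegnerPointsOfConductorGaloisOrbitPairBezout
import Literature.NumberTheory.EllipticCurves.HuShuYin2019.SylvesterCMPointsConductorNineP
import HarnessLib

/-!
# Gross 1991 Prop. 5.3 / Darmon 2004 Prop. 3.11 ON HU–SHU–YIN'S CM TOWER of `X₀(3⁵)`:
# complex conjugation acts on the CM point of conductor `9pn` as `±` a `Gal(K[9pn]/K)`-conjugate,
# modulo torsion — PROVED (no Heegner hypothesis: `K = ℚ(√−3)`, `3 ∣ N = 243` ramified)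

Topic `NumberTheory/EllipticCurves/HuShuYin2019`, namespace
`Literature.NumberTheory.EllipticCurves.HuShuYin2019`.  THEOREMS ONLY (no definition, no named fact,
no instance, no notation).  For the crux `UpperOffV0HSYPlus` (stmt-BirchSwinnertonDyer-19804), RESIDUE
c v3 (T-L1) clause l.81–82 («the Kolyvagin classes are admissible» = Gross Prop. 5.4, whose input is
Prop. 5.3).  The tree proves Darmon's Prop. 3.11 = Gross's Prop. 5.3 (`Darmon2004.prop311_complexConjugation_holds`)
under `SatisfiesHeegnerHypothesis N K ∧ gcd(n, N) = 1`; Hu–Shu–Yin's tower (`y_n ∈ E(K[9pn])` over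
`φ(τ_{Q^{(n)}})`, `Q^{(n)} = (n²A, nB, C)` the level-`243` Heegner form of conductor `9pn`,
`SylvesterCMPointsConductorNineP`) violates both.  Gross's printed proof («`x_n^τ = w_N(x_n^{σ′})`»,
«`w_N ∞` is the cusp `0` … torsion in the Jacobian») nevertheless runs VERBATIM on the tree's engines,
none of which needs the Heegner hypothesis: `φ(−τ̄) = conj φ(τ)` (`φ_J_smul`), `J • τ_Q = w_N • τ_{Q*}`
for the Fricke partner `Q* = fricke (negB Q) = (243C, B, A/243)` (`heegnerTau_negB_fricke`),
Atkin–Lehner at level `243` (`isNewform0_exists_frickeInvolution_eq_smul_two`, `φ_frickeGL_smul`),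
Manin–Drinfeld (`isOfFinAddOrder_cuspZeroPoint`), and the PAIR-FORM Shimura reciprocity in BEZOUT form
(`exists_mem_ringClassGal_map_pointGalHom_eq_of_residue_congr_bezout`, Bezout `u·243 + w·c = 1` =
`isCoprime_bezoutC`), the Fricke partner being a primitive level-`243` form of the same discriminant and
middle coefficient (§1, from `gcd(n, 3C) = 1` and the primitivity identity `bezout_B_C`).

* §1 `fricke_negB_sylvesterForm_eq`, `fricke_negB_sylvesterForm_mem_heegnerForms` — the Fricke partner
  `(243C, nB, n²(p²+4p+16)/3)` of `Q^{(n)}` is a Heegner form of level `243`, discriminant `−3(9pn)²`;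
* §2 ★ `exists_conj_sub_sign_smul_galois_isOfFinAddOrder_sylvesterTower` — for `K` imaginary quadratic
  with `d_K = −3`, `ι`, ANY `W/ℚ` elliptic with a datum `Dt : ModularParametrizationData W 243`,
  `p ≡ 1 (mod 3)`, `n ≠ 0`, `3 ∤ n`, `gcd(n, C) = 1`, `y ∈ E(K[9pn])` over `φ(τ_{Q^{(n)}})`, and
  `τ ∈ Aut_ℚ(K[9pn])` acting as complex conjugation: `∃ σ ∈ ringClassGal ι (9pn), ∃ e = ±1` with
  `(e : ℂ) = frickeEigenvalue Dt.f` (ONE sign for all `n`), `τ•y − e•σ•y` is torsion — Gross's `y_n^τ = ε y_n^{σ′} + (torsion)`;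
  `…_of_primeFactors` — the Kolyvagin-tower form (`n` a product of primes `≡ 2 (mod 3)`).

## References
* B. H. Gross, *Kolyvagin's work on modular elliptic curves*, LMS LNS 153 (1991), §5 (5.2), Prop. 5.3
  and proof (p. 243) [held `book:editornd-l-functions-arithmetic` p0197]. [GrossLMS1991]
* H. Darmon, *Rational points on modular elliptic curves*, CBMS 101 (2004), Prop. 3.11. [Darmon2004]
* B. H. Gross, *Heegner points on `X₀(N)`* (1984), §I.1, §5. [Gross1984]
* Y. Hu, J. Shu, H. Yin, *An explicit Gross–Zagier formula related to the Sylvester conjecture*,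
  Trans. AMS 372 (2019); arXiv 1708.05266 §4.1 (p. 10 L92: the point `P₁`). [HuShuYin2019]

## Mathlib / tree search
Tree: `Darmon2004.prop311_complexConjugation_holds` (template, Heegner hypothesis), `φ_J_smul`,
`HeegnerForm.heegnerTau_negB_fricke`, `HeegnerForm.fricke_fricke`, `HeegnerForm.negB_negB`, `φ_frickeGL_smul`,
`isFrickeEigen_of_frickeInvolution_eq_smul`, `isNewform0_exists_frickeInvolution_eq_smul_two`,
`IsNewform0.frickeInvolution_eq_smul_of`, `IsNewform0.frickeEigenvalue_eq_one_or_eq_neg_one_of`,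
`isOfFinAddOrder_cuspZeroPoint`, `exists_nsmul_modularSymbol_mem_periodLattice_of_isNewform0`,
`exists_mem_ringClassGal_map_pointGalHom_eq_of_residue_congr_bezout`, `sylvesterForm_mem_heegnerForms`,
`isCoprime_bezoutC`, `bezout_B_C`, `three_not_dvd_C`, `isCoprime_C_of_forall_prime_mod_three_eq_two`.
`lean search 'sylvesterTower.*conj|Reflection.*sylvester'` → nothing before this file.  presearch:
Gross 5.3 for CM points with `3 ∣ N` ramified → none in print ([corpus:book:burns2007-l-functions-galois-representations
p0563] Nekovář (3.3) avoids it; [corpus:paper:arxiv-1708.05266 p0008] HSY Prop. 3.3 only `n = 1`, abstract).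
-/

noncomputable section

open scoped Classical MatrixGroups ModularForm

open CongruenceSubgroup UpperHalfPlane Complex ComplexConjugate NumberField WeierstrassCurve

namespace Literature.NumberTheory.EllipticCurves.HuShuYin2019

open Literature.NumberTheory.EllipticCurves Literature.NumberTheory.EllipticCurves.ModularForms
  Literature.NumberTheory.EllipticCurves.HeegnerForm

variable {K : Type} [Field K] [NumberField K]

/-! ## §1 The Fricke partner of Hu–Shu–Yin's form is a level-`243` Heegner form -/

/-- The Fricke partner `fricke 243 (negB Q^{(n)}) = (243C, nB, n²(3k²+6k+7))` of `Q^{(n)} = (n²A, nB, C)`,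
`p = 3k + 1` (`A = 81(p²+4p+16) = 243(3k²+6k+7)`) — the form of Gross's «`w_N` of the conjugate point» for HSY's
`Q^{(n)}`. [cite: Gross1984, §I.1, §5 (x̄ = w_N x^σ)] [cite: HuShuYin2019, §4.1 (p. 10 L92: the point τ)] -/
theorem fricke_negB_sylvesterForm_eq (k n : ℕ) :
    HeegnerForm.fricke 243 (HeegnerForm.negB (((n : ℤ) ^ 2 * (81 * (((3 * k + 1 : ℕ) : ℤ) ^ 2 + 4 * (3 * k + 1 : ℕ) + 16)),
      (n : ℤ) * (-(9 * (4 * ((3 * k + 1 : ℕ) : ℤ) ^ 2 + 17 * (3 * k + 1 : ℕ) + 72))),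
      4 * ((3 * k + 1 : ℕ) : ℤ) ^ 2 + 18 * (3 * k + 1 : ℕ) + 81) : ℤ × ℤ × ℤ)) =
      ((4 * ((3 * k + 1 : ℕ) : ℤ) ^ 2 + 18 * (3 * k + 1 : ℕ) + 81) * 243,
        (n : ℤ) * (-(9 * (4 * ((3 * k + 1 : ℕ) : ℤ) ^ 2 + 17 * (3 * k + 1 : ℕ) + 72))),
        (n : ℤ) ^ 2 * (3 * (k : ℤ) ^ 2 + 6 * k + 7)) := by
  have hA : (n : ℤ) ^ 2 * (81 * (((3 * k + 1 : ℕ) : ℤ) ^ 2 + 4 * (3 * k + 1 : ℕ) + 16)) =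
      243 * ((n : ℤ) ^ 2 * (3 * (k : ℤ) ^ 2 + 6 * k + 7)) := by push_cast; ring
  refine Prod.ext ?_ (Prod.ext ?_ ?_)
  · simp [HeegnerForm.fricke, HeegnerForm.negB]
  · simp [HeegnerForm.fricke, HeegnerForm.negB]
  · simp only [HeegnerForm.fricke_snd_snd, HeegnerForm.negB_fst, Nat.cast_ofNat]
    rw [hA, Int.mul_ediv_cancel_left _ (by norm_num : (243 : ℤ) ≠ 0)]

/-- **The Fricke partner of `Q^{(n)}` is a primitive level-`243` Heegner form of discriminant
`−3·(9pn)²`** (`p = 3k+1`, `n ≠ 0`, `3 ∤ n`, `gcd(n, C) = 1`): discriminant and positivity are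
immediate, `243 ∣ 243C`; primitivity: a common divisor `d` of `243C`, `nB`, `n²(3k²+6k+7)` is prime to `n`
(`gcd(n, 3C) = 1`), so divides `B` and `3k²+6k+7 ≡ 1 (mod 3)`, hence is prime to `3`, divides `C`, and
divides `9C(19−4p) − B(4p−18) = 3⁷` (`bezout_B_C`) — a unit. [cite: Gross1984, §I.1 (𝔫, 𝔫̄ proper of norm N)]
[cite: HuShuYin2019, §4.1 (p. 10 L92)] -/
theorem fricke_negB_sylvesterForm_mem_heegnerForms {k n : ℕ} (hn : n ≠ 0) (hn3 : ¬ 3 ∣ n)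
    (hnC : IsCoprime (n : ℤ) (4 * ((3 * k + 1 : ℕ) : ℤ) ^ 2 + 18 * (3 * k + 1 : ℕ) + 81)) :
    HeegnerForm.fricke 243 (HeegnerForm.negB (((n : ℤ) ^ 2 * (81 * (((3 * k + 1 : ℕ) : ℤ) ^ 2 + 4 * (3 * k + 1 : ℕ) + 16)),
      (n : ℤ) * (-(9 * (4 * ((3 * k + 1 : ℕ) : ℤ) ^ 2 + 17 * (3 * k + 1 : ℕ) + 72))),
      4 * ((3 * k + 1 : ℕ) : ℤ) ^ 2 + 18 * (3 * k + 1 : ℕ) + 81) : ℤ × ℤ × ℤ)) ∈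
      heegnerForms 243 (((9 * (3 * k + 1) * n : ℕ) : ℤ) ^ 2 * (-3)) := by
  have hn0 : (0 : ℤ) < n := by exact_mod_cast Nat.pos_of_ne_zero hn
  rw [fricke_negB_sylvesterForm_eq]
  refine ⟨?_, ?_, ⟨_, mul_comm _ _⟩, ?_⟩
  · simp only
    push_cast
    ring
  · simp only
    have hC : (0 : ℤ) < 4 * ((3 * k + 1 : ℕ) : ℤ) ^ 2 + 18 * (3 * k + 1 : ℕ) + 81 := by positivity
    exact mul_pos hC (by norm_num)
  · intro d hdA hdB hdC
    simp only at hdA hdB hdC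
    -- `d` is prime to `n`: it divides `243 C`, and `gcd(n, 3) = gcd(n, C) = 1`
    have h3n : IsCoprime (3 : ℤ) (n : ℤ) := by
      exact_mod_cast Nat.isCoprime_iff_coprime.mpr ((Nat.Prime.coprime_iff_not_dvd Nat.prime_three).mpr hn3)
    have h243n : IsCoprime ((4 * ((3 * k + 1 : ℕ) : ℤ) ^ 2 + 18 * (3 * k + 1 : ℕ) + 81) * 243) (n : ℤ) := by
      refine IsCoprime.mul_left hnC.symm ?_
      have : (243 : ℤ) = 3 ^ 5 := by norm_num
      rw [this]
      exact IsCoprime.pow_left h3n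
    have hdn : IsCoprime d (n : ℤ) := h243n.of_isCoprime_of_dvd_left hdA
    -- hence `d ∣ B` and `d ∣ 3k² + 6k + 7`
    have hdB' : d ∣ -(9 * (4 * ((3 * k + 1 : ℕ) : ℤ) ^ 2 + 17 * (3 * k + 1 : ℕ) + 72)) :=
      hdn.dvd_of_dvd_mul_left hdB
    have hdA' : d ∣ 3 * (k : ℤ) ^ 2 + 6 * k + 7 :=
      (IsCoprime.pow_right (n := 2) hdn).dvd_of_dvd_mul_left hdC
    -- `d` is prime to `3` (`3k²+6k+7 ≡ 1`), hence to `243`, so `d ∣ C`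
    have h3A : IsCoprime (3 : ℤ) (3 * (k : ℤ) ^ 2 + 6 * k + 7) :=
      ⟨-((k : ℤ) ^ 2 + 2 * k + 2), 1, by ring⟩
    have hd3 : IsCoprime (3 : ℤ) d := h3A.of_isCoprime_of_dvd_right hdA'
    have hd243 : IsCoprime d (243 : ℤ) := by
      have : (243 : ℤ) = 3 ^ 5 := by norm_num
      rw [this]
      exact IsCoprime.pow_right hd3.symm
    have hdC' : d ∣ 4 * ((3 * k + 1 : ℕ) : ℤ) ^ 2 + 18 * (3 * k + 1 : ℕ) + 81 :=
      hd243.dvd_of_dvd_mul_right hdA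
    -- `d ∣ 9C(19 − 4p) − B(4p − 18) = 3⁷`, and `d` is prime to `3`
    have h2187 : d ∣ (2187 : ℤ) := by
      rw [← bezout_B_C (((3 * k + 1 : ℕ) : ℤ))]
      exact dvd_sub (dvd_mul_of_dvd_left (dvd_mul_of_dvd_right hdC' _) _) (dvd_mul_of_dvd_left hdB' _)
    have hd2187 : IsCoprime d (2187 : ℤ) := by
      have : (2187 : ℤ) = 3 ^ 7 := by norm_num
      rw [this]
      exact IsCoprime.pow_right hd3.symm
    exact hd2187.isUnit_of_dvd' (dvd_refl d) h2187

/-! ## §2 Gross's Prop. 5.3 on the tower -/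

set_option maxHeartbeats 1600000 in
/-- ★ **Gross 1991 Prop. 5.3 = Darmon 2004 Prop. 3.11 on Hu–Shu–Yin's CM tower** (`X₀(3⁵)`,
`K` imaginary quadratic with `d_K = −3`, conductor `9pn`; no Heegner hypothesis).  For ANY elliptic `W/ℚ`
with a parametrisation datum `Dt` at level `243`, `p ≡ 1 (mod 3)`, `n ≠ 0`, `3 ∤ n`, `gcd(n, C) = 1`,
`y ∈ E(K[9pn])` over `φ(τ_{Q^{(n)}})` and `τ ∈ Aut_ℚ(K[9pn])` acting on `K[9pn] ⊂ ℂ` as complex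
conjugation: there are `σ ∈ Gal(K[9pn]/K)` and a sign `e = ±1` (the Fricke eigenvalue of the newform)
with `τ•y − e•σ•y` torsion — *"`y_n^τ = ε · y_n^{σ′} + (torsion)` in `E(K_n)`, for some `σ′ ∈ 𝒢_n`"*.
Proof = Gross's: `conj φ(τ_Q) = φ(J•τ_Q) = φ(w_N•τ_{Q*}) = e φ(τ_{Q*}) + φ(0)`, `φ(τ_{Q*}) = σ•y`
(pair-form reciprocity, Bezout form), `φ(0)` torsion (Manin–Drinfeld).
[cite: GrossLMS1991, Prop. 5.3 and proof (p. 243), (5.2)] [cite: Darmon2004, Prop. 3.11 (p. 36)]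
[cite: Gross1984, §5] [cite: HuShuYin2019, §4.1 (p. 10 L92)] -/
theorem exists_conj_sub_sign_smul_galois_isOfFinAddOrder_sylvesterTower (hK : IsImaginaryQuadratic K)
    (hdK : NumberField.discr K = -3) (ι : K →+* ℂ) {W : WeierstrassCurve ℚ} [W.IsElliptic]
    (Dt : ModularParametrizationData W 243) {p n : ℕ} (hp : p % 3 = 1) (hn : n ≠ 0) (hn3 : ¬ 3 ∣ n)
    (hnC : IsCoprime (n : ℤ) (4 * (p : ℤ) ^ 2 + 18 * p + 81))
    {y : (W.baseChange (ringClassField K ι (9 * p * n))).toAffine.Point}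
    (hy : WeierstrassCurve.Affine.Point.map (W' := W) (ringClassField K ι (9 * p * n)).subtype.toRatAlgHom y =
      Dt.φ (heegnerTau ((n : ℤ) ^ 2 * (81 * ((p : ℤ) ^ 2 + 4 * p + 16)),
        (n : ℤ) * (-(9 * (4 * (p : ℤ) ^ 2 + 17 * p + 72))), 4 * (p : ℤ) ^ 2 + 18 * p + 81)))
    {τ : ringClassField K ι (9 * p * n) ≃ₐ[ℚ] ringClassField K ι (9 * p * n)}
    (hτ : ∀ x : ringClassField K ι (9 * p * n), ((τ x : ringClassField K ι (9 * p * n)) : ℂ) = conj (x : ℂ)) :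
    ∃ σ ∈ ringClassGal ι (9 * p * n), ∃ e : ℤ, (e = 1 ∨ e = -1) ∧ (e : ℂ) = frickeEigenvalue Dt.f ∧ IsOfFinAddOrder
      (pointGalHom W (ringClassField K ι (9 * p * n)) τ y -
        e • pointGalHom W (ringClassField K ι (9 * p * n)) σ y) := by
  haveI : NeZero (243 : ℕ) := ⟨by norm_num⟩
  obtain ⟨k, rfl⟩ : ∃ k, p = 3 * k + 1 := ⟨p / 3, by omega⟩
  have hp0 : 3 * k + 1 ≠ 0 := by omega
  have hm : 9 * (3 * k + 1) * n ≠ 0 := mul_ne_zero (mul_ne_zero (by norm_num) hp0) hn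
  have hm0 : (0 : ℤ) < ((9 * (3 * k + 1) * n : ℕ) : ℤ) := by exact_mod_cast Nat.pos_of_ne_zero hm
  have hDn : ((9 * (3 * k + 1) * n : ℕ) : ℤ) ^ 2 * NumberField.discr K < 0 :=
    mul_neg_of_pos_of_neg (pow_pos hm0 2) hK.discr_neg
  -- the form `Q = Q^{(n)}` and its Fricke partner `Q* = fricke (negB Q)` (same middle coefficient)
  set Q : ℤ × ℤ × ℤ := ((n : ℤ) ^ 2 * (81 * (((3 * k + 1 : ℕ) : ℤ) ^ 2 + 4 * (3 * k + 1 : ℕ) + 16)),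
      (n : ℤ) * (-(9 * (4 * ((3 * k + 1 : ℕ) : ℤ) ^ 2 + 17 * (3 * k + 1 : ℕ) + 72))),
      4 * ((3 * k + 1 : ℕ) : ℤ) ^ 2 + 18 * (3 * k + 1 : ℕ) + 81) with hQdef
  have hQ : Q ∈ heegnerForms 243 (((9 * (3 * k + 1) * n : ℕ) : ℤ) ^ 2 * NumberField.discr K) := by
    rw [hdK]; exact sylvesterForm_mem_heegnerForms hp hn hnC
  set Qs := HeegnerForm.fricke 243 (HeegnerForm.negB Q) with hQsdef
  have hQs : Qs ∈ heegnerForms 243 (((9 * (3 * k + 1) * n : ℕ) : ℤ) ^ 2 * NumberField.discr K) := by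
    rw [hdK]; exact fricke_negB_sylvesterForm_mem_heegnerForms hn hn3 hnC
  have hQsB : Qs.2.1 = Q.2.1 := by simp [hQsdef, HeegnerForm.negB, HeegnerForm.fricke]
  have hback : HeegnerForm.negB (HeegnerForm.fricke 243 Qs) = Q := by
    rw [hQsdef, HeegnerForm.fricke_fricke (by norm_num) (by simpa using hQ.2.2.1), HeegnerForm.negB_negB]
  -- `J • τ_Q = w_N • τ_{Q*}`
  have hJx : J • heegnerTau Q =
      ModularForms.glCast (ModularForms.frickeGL 243 : GL (Fin 2) ℚ) • heegnerTau Qs := by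
    rw [← hback, HeegnerForm.heegnerTau_negB_fricke hDn hQs, J_smul_J_smul]
  -- Atkin–Lehner at level `243` (tree): `f ∣ w_N = e f`, `e = ±1`, pointwise Fricke property
  have hAL : IsNewform0.exists_frickeInvolution_eq_smul (N := 243) (k := (2 : ℤ)) :=
    isNewform0_exists_frickeInvolution_eq_smul_two 243
  have hw : frickeInvolution 243 2 Dt.f = frickeEigenvalue Dt.f • Dt.f :=
    IsNewform0.frickeInvolution_eq_smul_of hAL Dt.isNewformOf.1
  obtain ⟨e, he, he1⟩ : ∃ e : ℤ, (e : ℂ) = frickeEigenvalue Dt.f ∧ (e = 1 ∨ e = -1) := by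
    rcases IsNewform0.frickeEigenvalue_eq_one_or_eq_neg_one_of hAL Dt.isNewformOf.1 with h | h
    · exact ⟨1, by rw [h]; norm_num, Or.inl rfl⟩
    · exact ⟨-1, by rw [h]; norm_num, Or.inr rfl⟩
  have hW : IsFrickeEigen 243 Dt.f (e : ℂ) := by
    rw [he]
    exact isFrickeEigen_of_frickeInvolution_eq_smul 243 hw
  -- Manin–Drinfeld (tree): `φ(0)` is torsion
  have hT : IsOfFinAddOrder Dt.cuspZeroPoint :=
    isOfFinAddOrder_cuspZeroPoint Dt (exists_nsmul_modularSymbol_mem_periodLattice_of_isNewform0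
      Dt.isNewformOf.1 Dt.isNewformOf.coeffField_eq_bot)
  -- Shimura reciprocity on the tower, pair form with the Bezout datum `u·243 + w·c = 1`
  obtain ⟨u, w, huw⟩ := isCoprime_bezoutC (k := k) (n := n) hn3
  obtain ⟨σ', hσ', hrec⟩ := exists_mem_ringClassGal_map_pointGalHom_eq_of_residue_congr_bezout hK ι Dt hm
    (β := (n : ℤ) * (-(9 * (4 * ((3 * k + 1 : ℕ) : ℤ) ^ 2 + 17 * (3 * k + 1 : ℕ) + 72))))
    (c := (n : ℤ) ^ 2 * (3 * (k : ℤ) ^ 2 + 6 * k + 7) *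
      (4 * ((3 * k + 1 : ℕ) : ℤ) ^ 2 + 18 * (3 * k + 1 : ℕ) + 81))
    (u := u) (v := 0) (w := w) (by rw [hdK]; push_cast; ring) (by linear_combination huw)
    hQ hQs (Int.ModEq.refl _) (by rw [hQsB]) hy
  refine ⟨σ', hσ', e, he1, he, ?_⟩
  -- complex coordinates: `τ` acts as complex conjugation
  have hτP : WeierstrassCurve.Affine.Point.map (W' := W) (ringClassField K ι (9 * (3 * k + 1) * n)).subtype.toRatAlgHom
      (pointGalHom W (ringClassField K ι (9 * (3 * k + 1) * n)) τ y) = conjPoint W (Dt.φ (heegnerTau Q)) := by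
    have hcomp : (ringClassField K ι (9 * (3 * k + 1) * n)).subtype.toRatAlgHom.comp
        (τ : ringClassField K ι (9 * (3 * k + 1) * n) →ₐ[ℚ] ringClassField K ι (9 * (3 * k + 1) * n)) =
        conjRatAlgHom.comp (ringClassField K ι (9 * (3 * k + 1) * n)).subtype.toRatAlgHom := by
      apply AlgHom.ext
      intro x
      simpa using hτ x
    rw [pointGalHom_apply, WeierstrassCurve.Affine.Point.map_map, hcomp,
      ← WeierstrassCurve.Affine.Point.map_map, hy]
  -- `conj φ(τ_Q) − e φ(τ_{Q*}) = φ(J τ_Q) − e φ(τ_{Q*}) = φ(w_N τ_{Q*}) − e φ(τ_{Q*}) = φ(0)`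
  have key : WeierstrassCurve.Affine.Point.map (W' := W) (ringClassField K ι (9 * (3 * k + 1) * n)).subtype.toRatAlgHom
      (pointGalHom W (ringClassField K ι (9 * (3 * k + 1) * n)) τ y -
        e • pointGalHom W (ringClassField K ι (9 * (3 * k + 1) * n)) σ' y) = Dt.cuspZeroPoint := by
    rw [map_sub, map_zsmul, hτP, hrec, ← φ_J_smul, hJx, φ_frickeGL_smul Dt hW, add_sub_cancel_left]
  obtain ⟨k', hk', hk0⟩ := hT.exists_nsmul_eq_zero
  refine isOfFinAddOrder_iff_nsmul_eq_zero.mpr ⟨k', hk', ?_⟩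
  apply WeierstrassCurve.Affine.Point.map_injective (W' := W)
    (f := (ringClassField K ι (9 * (3 * k + 1) * n)).subtype.toRatAlgHom)
  rw [map_nsmul, key, hk0, map_zero]

/-- **Kolyvagin-tower form**: the same for `n ≠ 0` a product of primes `≡ 2 (mod 3)` (then `3 ∤ n`
and `gcd(n, C) = 1`, `isCoprime_C_of_forall_prime_mod_three_eq_two`). [cite: GrossLMS1991, Prop. 5.3 (p. 243)]
[cite: HuShuYin2019, §4.1 (p. 10 L92)] -/
theorem exists_conj_sub_sign_smul_galois_isOfFinAddOrder_sylvesterTower_of_primeFactors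
    (hK : IsImaginaryQuadratic K) (hdK : NumberField.discr K = -3) (ι : K →+* ℂ)
    {W : WeierstrassCurve ℚ} [W.IsElliptic] (Dt : ModularParametrizationData W 243) {p n : ℕ}
    (hp : p % 3 = 1) (hn : n ≠ 0) (hn3 : ∀ q ∈ n.primeFactors, q % 3 = 2)
    {y : (W.baseChange (ringClassField K ι (9 * p * n))).toAffine.Point}
    (hy : WeierstrassCurve.Affine.Point.map (W' := W) (ringClassField K ι (9 * p * n)).subtype.toRatAlgHom y =
      Dt.φ (heegnerTau ((n : ℤ) ^ 2 * (81 * ((p : ℤ) ^ 2 + 4 * p + 16)),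
        (n : ℤ) * (-(9 * (4 * (p : ℤ) ^ 2 + 17 * p + 72))), 4 * (p : ℤ) ^ 2 + 18 * p + 81)))
    {τ : ringClassField K ι (9 * p * n) ≃ₐ[ℚ] ringClassField K ι (9 * p * n)}
    (hτ : ∀ x : ringClassField K ι (9 * p * n), ((τ x : ringClassField K ι (9 * p * n)) : ℂ) = conj (x : ℂ)) :
    ∃ σ ∈ ringClassGal ι (9 * p * n), ∃ e : ℤ, (e = 1 ∨ e = -1) ∧ (e : ℂ) = frickeEigenvalue Dt.f ∧ IsOfFinAddOrder
      (pointGalHom W (ringClassField K ι (9 * p * n)) τ y -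
        e • pointGalHom W (ringClassField K ι (9 * p * n)) σ y) := by
  have h3n : ¬ 3 ∣ n := fun h ↦ by
    have := hn3 3 (Nat.mem_primeFactors.mpr ⟨Nat.prime_three, h, hn⟩)
    omega
  exact exists_conj_sub_sign_smul_galois_isOfFinAddOrder_sylvesterTower hK hdK ι Dt hp hn h3n
    (isCoprime_C_of_forall_prime_mod_three_eq_two hn hn3) hy hτ

end Literature.NumberTheory.EllipticCurves.HuShuYin2019

end
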